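import Summits.BirchSwinnertonDyer.BirchSwinnertonDyer.Theorems.ResidualThetaTransportAtTwoSignedMuSeedAtTwoPlusTiltUnitTower
import HarnessLib

/-!
# Seed crux `SignedMuSeedAtTwoPlus` (stmt-BirchSwinnertonDyer-21438), line `norm-field-tilt`:
# the VALUATION of the orbit product — `v(Z'_{ρ,m}) = 2^m · v(θ̄^ρ) = 2^{m+2}`

Cell `bsd-wall`, width seat `bsd-wall-rtt-p4-w2` g10; eleventh file on the line, on top of p659696 (`…TiltUnitTower`,
whose hypotheses `Z_m ≠ 0` and `ord Z_m = 2^{m+2}` are DISCHARGED here from `ord θ = 4`).  HONEST FRAMING: THEOREMS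
ONLY; closes no item; the line is NOT registered; BSD is NOT proved by this.

## What is proved

Over an integral domain `k`:
* `coeff_order_subst` / `order_subst_of_order_eq_one` — substituting a series `φ` of order `1` preserves the order:
  `ord θ(φ) = ord θ` (the coefficient of `t^v` in `θ(φ)` is `θ_v·φ₁^v`);
* `order_orbitProd` — for a family `e_j` of series of order `1`, `ord ∏_{j<n} θ(e_j) = n·ord θ`;
* `order_map_hom_pow` — the reduced Lubin–Tate endomorphism `[gʲ]‾` has order `1` when `g ≡ 1 + π w₀` (so
  `g ≡ 1 (mod π)`) and `A/π` is non-trivial (`[a] ≡ aX (mod deg 2)`);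
* **`oddDigit_of_nonDeg_theta`** — p659696's `oddDigit_of_nonDeg_orbit_of_generator` with `Z_m ≠ 0` and
  `ord Z_m = 2^{m+2}` replaced by the single hypothesis **`ord θ = 4`** (the card's `v(θ̄^ρ) = 2·v(θ̄) = 4`:
  `θ̄ = w/(t + x_P w)` has order `2`).

After this file, for `Z_m = ∏_{j<2^m} θ([gʲ]‾ t)` the inference `NonDeg(m₀) ⟹ OddDigit(m)` (`m ≥ m₀ + 2`) rests on:
the Lubin–Tate datum `(A, π, 4, f)` with `2 = πc`, `c ∉ (π)`, a Weierstrass model `U` (`U.formalGroupLaw = F_f`,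
`a₁ ≡ 0`), `g = 1 + πw₀` (`w̄₀ ∉ {0, −c̄}`), a series `θ` of order `4`, the `D log`s `S_m` (`Z_m·S_m = η̄·Z_m'`), the
digits `Z_m ≡ P_m(s_m) (mod t^{3·4^m})` (stub S1: membership), and `NonDeg(m₀)` (stub S4). [folklore]
-/

noncomputable section

set_option autoImplicit false
set_option linter.dupNamespace false

open PowerSeries
open Literature.NumberTheory.GaloisRepresentations

namespace Summit.BirchSwinnertonDyer.BirchSwinnertonDyer.Theorems.SignedMuAtTwo.Tilt

section Domain

variable {k : Type*} [CommRing k] [IsDomain k]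

/-- The coefficient of `t^v` in `θ(φ)`, `v = ord θ`, `ord φ = 1`: it is `θ_v · φ₁^v`. [folklore] -/
theorem coeff_order_subst {θ φ : PowerSeries k} (hφ : φ.order = 1) {v : ℕ} (hθ : θ.order = v) :
    coeff v (θ.subst φ) = coeff v θ * (coeff 1 φ) ^ v := by
  have hφ0 : constantCoeff φ = 0 := by
    have := coeff_of_lt_order (φ := φ) 0 (by rw [hφ]; norm_num)
    rwa [coeff_zero_eq_constantCoeff_apply] at this
  have hs : HasSubst φ := HasSubst.of_constantCoeff_zero' hφ0
  rw [coeff_subst' hs, finsum_eq_single _ v]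
  · -- the term `d = v`: `coeff v (φ^v) = φ₁^v`
    rw [smul_eq_mul]
    congr 1
    have hX : φ = X * φ.divXPowOrder := by
      have h := (X_pow_order_mul_divXPowOrder (f := φ)).symm
      rwa [hφ, show ((1 : ℕ∞)).toNat = 1 from rfl, pow_one] at h
    have hc : coeff 1 φ = constantCoeff φ.divXPowOrder := by
      conv_lhs => rw [hX]
      rw [show (1 : ℕ) = 0 + 1 from rfl, ← pow_one X, coeff_X_pow_mul, coeff_zero_eq_constantCoeff_apply]
    rw [hc, hX, mul_pow, coeff_X_pow_mul', if_pos le_rfl, Nat.sub_self, coeff_zero_eq_constantCoeff_apply,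
      map_pow, ← hX]
  · intro d hd
    rcases Nat.lt_or_gt_of_ne hd with h | h
    · rw [coeff_of_lt_order d (by rw [hθ]; exact_mod_cast h), zero_smul]
    · have hvd : (v : ℕ∞) < (φ ^ d).order := by
        rw [order_pow, hφ, nsmul_eq_mul, mul_one]
        exact_mod_cast h
      rw [coeff_of_lt_order v hvd, smul_zero]

/-- **Substituting a series of order `1` preserves the order.** [folklore] -/
theorem order_subst_of_order_eq_one {θ φ : PowerSeries k} (hφ : φ.order = 1) :
    PowerSeries.order (θ.subst φ) = θ.order := by
  have hφ0 : constantCoeff φ = 0 := by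
    have := coeff_of_lt_order (φ := φ) 0 (by rw [hφ]; norm_num)
    rwa [coeff_zero_eq_constantCoeff_apply] at this
  by_cases hθ0 : θ = 0
  · subst hθ0
    rw [← coe_substAlgHom (HasSubst.of_constantCoeff_zero' hφ0), map_zero]
  · obtain ⟨v, hv⟩ : ∃ v : ℕ, θ.order = v :=
      ⟨θ.order.toNat, (coe_toNat_order hθ0).symm⟩
    rw [hv]
    apply le_antisymm
    · apply order_le
      rw [coeff_order_subst hφ hv]
      refine mul_ne_zero ?_ (pow_ne_zero _ ?_)
      · have := coeff_order hθ0; rwa [hv] at this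
      · have := coeff_order (φ := φ) (by rintro rfl; simp at hφ); rwa [hφ] at this
    · rw [← hv]; exact le_order_subst_left' hφ0

/-- **The orbit product has order `n · ord θ`** when every `e_j` has order `1`. [folklore] -/
theorem order_orbitProd (e : ℕ → PowerSeries k) (he : ∀ j, (e j).order = 1) (θ : PowerSeries k) (n : ℕ) :
    PowerSeries.order (∏ j ∈ Finset.range n, (θ.subst (e j) : PowerSeries k)) = n • θ.order := by
  rw [order_prod, Finset.sum_congr rfl fun j _ => order_subst_of_order_eq_one (he j), Finset.sum_const,
    Finset.card_range]

end Domain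

/-! ## The reduced endomorphisms `[gʲ]‾` have order `1` -/

variable {A : Type*} [CommRing A] {π : A} {q : ℕ} (hA : LubinTate.IsLTRing π q) {f : PowerSeries A}
  (hf : LubinTate.IsLTSeries π q f)

/-- `ord [a]‾ = 1` when `a ∉ (π)` and `A/π` is a domain (`[a] ≡ aX (mod deg 2)`). [folklore] -/
theorem order_map_hom [IsDomain (A ⧸ Ideal.span {π})] {a : A} (ha : a ∉ Ideal.span {π}) :
    ((LubinTate.hom hA hf hf a).map (Ideal.Quotient.mk (Ideal.span {π}))).order = 1 := by
  simpa using order_pow_map_hom hA hf 0 ha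

/-- `g = 1 + π·w₀ ⟹ gʲ ∉ (π)` (for `(π)` prime, i.e. `A/π` a domain). [folklore] -/
theorem pow_not_mem_of_eq_one_add [IsDomain (A ⧸ Ideal.span {π})] {g w₀ : A} (hg : g = 1 + π * w₀) (j : ℕ) :
    g ^ j ∉ Ideal.span {π} := by
  have hprime : (Ideal.span {π}).IsPrime := (Ideal.Quotient.isDomain_iff_prime _).mp inferInstance
  have hg1 : g ∉ Ideal.span {π} := fun h => by
    have h1 : (1 : A) ∈ Ideal.span {π} := by
      have : (1 : A) = g - π * w₀ := by rw [hg]; ring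
      rw [this]
      exact Ideal.sub_mem _ h (Ideal.mul_mem_right _ _ (Ideal.mem_span_singleton_self π))
    exact hprime.ne_top ((Ideal.eq_top_iff_one _).mpr h1)
  exact fun h => hg1 (hprime.mem_of_pow_mem j h)

/-- **`ord [gʲ]‾ = 1`** for `g = 1 + π·w₀` over a domain `A/π`. [folklore] -/
theorem order_map_hom_pow [IsDomain (A ⧸ Ideal.span {π})] {g w₀ : A} (hg : g = 1 + π * w₀) (j : ℕ) :
    ((LubinTate.hom hA hf hf (g ^ j)).map (Ideal.Quotient.mk (Ideal.span {π}))).order = 1 :=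
  order_map_hom hA hf (pow_not_mem_of_eq_one_add hg j)

/-- **`ord Z_m = 2^m · ord θ`** for the reduced orbit product `Z_m = ∏_{j<2^m} θ([gʲ]‾t)`, `g = 1 + π·w₀`; in particular
`ord θ = 4 ⟹ ord Z_m = 2^{m+2}` and `Z_m ≠ 0`. [folklore] -/
theorem order_orbitProd_hom [IsDomain (A ⧸ Ideal.span {π})] {g w₀ : A} (hg : g = 1 + π * w₀)
    {θ : PowerSeries (A ⧸ Ideal.span {π})} (hθ : θ.order = (4 : ℕ)) (m : ℕ) :
    PowerSeries.order (∏ j ∈ Finset.range (2 ^ m),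
        (θ.subst ((LubinTate.hom hA hf hf (g ^ j)).map (Ideal.Quotient.mk (Ideal.span {π}))) :
          PowerSeries (A ⧸ Ideal.span {π}))) = (2 ^ (m + 2) : ℕ) := by
  rw [order_orbitProd _ (fun j => order_map_hom_pow hA hf hg j) θ (2 ^ m), hθ]
  simp only [nsmul_eq_mul]
  push_cast
  ring

/-! ## The engine with `ord θ = 4` -/

/-- **The tilt engine for the orbit product of a series of order `4`** (p659696 with `Z_m ≠ 0`, `ord Z_m = 2^{m+2}`
discharged).  Hypotheses: Lubin–Tate datum `(A, π, 4, f)`, `A/π` a domain, `2 = π·c` with `c ∉ (π)`; Weierstrass model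
`U/A` with `U.formalGroupLaw = F_f` and `a₁ ≡ 0 (mod π)`; `g = 1 + π·w₀`, `w₀ ∉ (π)`, `w₀ + c ∉ (π)`; a series `θ` over
`A/π` of ORDER `4`; `Z_m := ∏_{j<2^m} θ([gʲ]‾t)`; `S_m` with `Z_m·S_m = η̄·Z_m'`; digits `Z_m ≡ P_m(s_m) (mod t^{3·4^m})`.
Then `ord S_{m₀} = a₀`, `a₀ + 2 < 4^{m₀+1}` ⟹ for every `m ≥ m₀ + 2` some odd-degree coefficient of `P_m` is non-zero.
[folklore] -/
theorem oddDigit_of_nonDeg_theta (hA4 : LubinTate.IsLTRing π 4) {f4 : PowerSeries A}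
    (hf4 : LubinTate.IsLTSeries π 4 f4) [IsDomain (A ⧸ Ideal.span {π})]
    {c : A} (h2 : (2 : A) = π * c) (hc : c ∉ Ideal.span {π})
    (U : WeierstrassCurve A) (hU : U.formalGroupLaw = LubinTate.ltF hA4 hf4)
    (ha₁ : (U.map (Ideal.Quotient.mk (Ideal.span {π}))).a₁ = 0)
    {g w₀ : A} (hg : g = 1 + π * w₀) (hw₀ : w₀ ∉ Ideal.span {π}) (hw₀c : w₀ + c ∉ Ideal.span {π})
    {θ : PowerSeries (A ⧸ Ideal.span {π})} (hθ : θ.order = (4 : ℕ))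
    (S s : ℕ → PowerSeries (A ⧸ Ideal.span {π})) (P : ℕ → Polynomial (A ⧸ Ideal.span {π}))
    (hZS : ∀ m, (∏ j ∈ Finset.range (2 ^ m),
        (θ.subst ((LubinTate.hom hA4 hf4 hf4 (g ^ j)).map (Ideal.Quotient.mk (Ideal.span {π}))) :
          PowerSeries (A ⧸ Ideal.span {π}))) * S m =
      (U.map (Ideal.Quotient.mk (Ideal.span {π}))).formalEta *
        d⁄dX (A ⧸ Ideal.span {π}) (∏ j ∈ Finset.range (2 ^ m),
          (θ.subst ((LubinTate.hom hA4 hf4 hf4 (g ^ j)).map (Ideal.Quotient.mk (Ideal.span {π}))) :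
            PowerSeries (A ⧸ Ideal.span {π}))))
    (hmem : ∀ m, (X : PowerSeries (A ⧸ Ideal.span {π})) ^ (3 * 4 ^ m) ∣
      (∏ j ∈ Finset.range (2 ^ m),
        (θ.subst ((LubinTate.hom hA4 hf4 hf4 (g ^ j)).map (Ideal.Quotient.mk (Ideal.span {π}))) :
          PowerSeries (A ⧸ Ideal.span {π}))) - Polynomial.aeval (s m) (P m))
    {m₀ a₀ : ℕ} (ha₀ : (S m₀).order = a₀) (hnd : a₀ + 2 < 4 ^ (m₀ + 1))
    {m : ℕ} (hm : m₀ + 2 ≤ m) : ∃ i, Odd i ∧ (P m).coeff i ≠ 0 := by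
  have hZord := order_orbitProd_hom hA4 hf4 hg hθ
  refine oddDigit_of_nonDeg_orbit_of_generator hA4 hf4 h2 hc U hU ha₁ hg hw₀ hw₀c θ S s P (fun n h0 => ?_)
    hZS hZord hmem ha₀ hnd hm
  have := hZord n
  rw [h0, order_zero] at this
  exact ENat.top_ne_coe _ this

end Summit.BirchSwinnertonDyer.BirchSwinnertonDyer.Theorems.SignedMuAtTwo.Tilt

end
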